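import Summits.QuantumFields.GaugeBoot.Rows.KZL2rpD3LTab
import HarnessLib

/-!
# Gauge-boot: kernel check of the raw `link1` class table of the kz-L2-rp-3D problems, rows 205–300 (part 6/6)

Cell `pub-gaugeboot` (HOME `run/shared/lean/pub/pub-gaugeboot/`), seat lean1 (torus positivity layer for rows C15–C19, C34–C40 (+ the w1x2 / w1x3 / w2x2 windows of the same family) =
the certified kz-L2-rp-3D windows: label set, reflection lines, class/witness tables, the reduction identity; Hermitian half transported from `KZL2HD3`).

HONEST FRAMING (page 1 of every file of this cell): certified bounds on lattice expectations at STATED coupling,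
gauge group, dimension and torus size; NOT a mass gap, NOT a continuum limit, NOT a string tension, NOT large `N`.
The venture is explicitly NOT Yang–Mills-summit-bearing (barriers `FixedCouplingUltralocality`,
`PerturbativeInvisibility`).

`lcanon_rows_<lo>_<hi> : ∀ i, lo ≤ i < hi → ∀ j ≥ i, KZL2rpD3.LCanonOK i j`, each range one closed computation (`decide +kernel`,
≤ 900 entries per theorem — farm calibration for D = 3 reflection words); assembled in `KZL2rpD3Red`.
-/

noncomputable section

open Literature.MathematicalPhysics.QuantumFieldTheory

namespace Summit.QuantumFields.GaugeBoot

namespace KZL2rpD3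

set_option maxHeartbeats 0 in
/-- Rows `205 ≤ i < 215` of the `link1` class table of the kz-L2-rp-3D problems canonicalise (915 entries; kernel). -/
theorem lcanon_rows_205_215 : ∀ i : Fin 301, 205 ≤ i.val → i.val < 215 → ∀ j : Fin 301, i.val ≤ j.val → KZL2rpD3.LCanonOK i j := by
  decide +kernel

set_option maxHeartbeats 0 in
/-- Rows `215 ≤ i < 227` of the `link1` class table of the kz-L2-rp-3D problems canonicalise (966 entries; kernel). -/
theorem lcanon_rows_215_227 : ∀ i : Fin 301, 215 ≤ i.val → i.val < 227 → ∀ j : Fin 301, i.val ≤ j.val → KZL2rpD3.LCanonOK i j := by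
  decide +kernel

set_option maxHeartbeats 0 in
/-- Rows `227 ≤ i < 241` of the `link1` class table of the kz-L2-rp-3D problems canonicalise (945 entries; kernel). -/
theorem lcanon_rows_227_241 : ∀ i : Fin 301, 227 ≤ i.val → i.val < 241 → ∀ j : Fin 301, i.val ≤ j.val → KZL2rpD3.LCanonOK i j := by
  decide +kernel

set_option maxHeartbeats 0 in
/-- Rows `241 ≤ i < 259` of the `link1` class table of the kz-L2-rp-3D problems canonicalise (927 entries; kernel). -/
theorem lcanon_rows_241_259 : ∀ i : Fin 301, 241 ≤ i.val → i.val < 259 → ∀ j : Fin 301, i.val ≤ j.val → KZL2rpD3.LCanonOK i j := by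
  decide +kernel

set_option maxHeartbeats 0 in
/-- Rows `259 ≤ i < 299` of the `link1` class table of the kz-L2-rp-3D problems canonicalise (900 entries; kernel). -/
theorem lcanon_rows_259_299 : ∀ i : Fin 301, 259 ≤ i.val → i.val < 299 → ∀ j : Fin 301, i.val ≤ j.val → KZL2rpD3.LCanonOK i j := by
  decide +kernel

set_option maxHeartbeats 0 in
/-- Rows `299 ≤ i < 301` of the `link1` class table of the kz-L2-rp-3D problems canonicalise (3 entries; kernel). -/
theorem lcanon_rows_299_301 : ∀ i : Fin 301, 299 ≤ i.val → i.val < 301 → ∀ j : Fin 301, i.val ≤ j.val → KZL2rpD3.LCanonOK i j := by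
  decide +kernel

end KZL2rpD3

end Summit.QuantumFields.GaugeBoot

end
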